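import Summits.BirchSwinnertonDyer.BirchSwinnertonDyer.Theses.TangentCone

set_option linter.dupNamespace false

/-!
# Disproof of `EdgeCap` (crux `stmt-BirchSwinnertonDyer-17609`, route TangentCone) — findings

Standing disprover's work file (`cdisprove`, cycle 1, 2026-08-17). Prose lives in docstrings only.

## Verdict so far: NO KILL — and why the crux resists

1. **Immune to finite computation.** The conclusion has the shape `∃ J C, ∀ k g ι s, … → ∃ j, …`;
   any finite family of weights `k` is absorbed by the constant `C`. Only an UNBOUNDED undershoot
   `v_p(ι R_k) - s_p·(1 + v_p(k-2)) → -∞` along branch members refutes, i.e. a theorem about the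
   two-variable p-adic L-function of the Hida branch itself (no `kit` table can do it).
2. **Immune to in-tree refutation (construction debt on both sides).**
   (a) the outer hypotheses `HasSurjectiveModNGaloisRep p` and `(Br)` cannot be discharged for any
       concrete `W` in the present tree (no computed Galois images, no classification of the
       newforms of level dividing `N·p`);
   (b) the conclusion can only fail at a genuine newform `g` with evaluated Mellin transforms;
       the only constructible candidate `g = 0` SATISFIES the conclusion (`R = 0/0 = 0`,
       `ratio_eq_zero_of_eq_zero`, `bound_of_ratio_eq_zero` below) and is excluded anyway by
       `IsNormalized` inside `IsNewform0` (`not_isNewform0_zero`).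
   Hence no variant `EdgeCapWithout<H>` is refutable in-tree either: the load-bearing analysis of
   §3 is ON PAPER (docstrings), only the arithmetic of the typed side conditions is CHECKED (§1).
3. **Typing read-back** (`W.lean`, rc 0): `(2:ℤ)*↑b*(↑p-1) ∣ k-2` (cast before subtraction, benign);
   `↑t ^ (s - (1:ℕ))` uses ℕ-subtraction but `1 ≤ s` is forced (§1); `j - (1:ℕ)` with `3 ≤ j`;
   `padicValInt p (k-2)` with `k - 2 ≠ 0`; the real exponent is a ℕ; division by a vanishing
   denominator gives `R = 0`, which only helps the prover. No junk operator bites the refuter's way.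
4. **Mathematical status.** EdgeCap ⇐ (two-variable IMC divisibility `char X_∞ ∣ L_p` on the
   branch, Ochiai 2005/2006) + (control at (2,1): `s_p ≤` total order of `char X_∞`, which needs
   `X_∞` to have NO non-zero pseudo-null submodule — e.g. `X = Λ₂/(κ,σ)` has `char = 1` but
   `X/(κ,σ)X ≅ ℤ_p`; Greenberg's structure theorems are the expected supply) + Hida bookkeeping
   ((Br) ⇒ `𝕋_𝔪 ≅ Λ` ⇒ one branch member `(g_k, ι_k)` per weight, new of level exactly `N`) +
   Weierstrass preparation along the arc `σ = (1+κ)^{a/b} - 1` + boundedness of the reference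
   denominators `L_p^{(j-1)}(κ_k, σ_j)` for SOME odd `j ≤ 2J+1` (compactness of the closure of
   `{κ_k}`; numerator and denominator both come from the `+` part of the Λ-adic modular symbol since
   `s ≡ j ≡ 1 (mod 2)`, so a common vertical divisor cancels in the ratio). The ONLY scenario found in
   which EdgeCap is false with the IMC true is a pseudo-null submodule of `X_∞` supported at (2,1):
   a proof obligation for the prover, not a refutation lead (no tree object states it).
5. **Hypothesis mutation (paper; §3):** load-bearing = (Br), ordinarity of `g`, congruence of `g`,
   the modulus `b·(p-1)` inside `2b(p-1)` (clears `b`, forces `s` odd and `s ≡ 1 mod p-1`, i.e. the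
   ω⁰ branch), and the rate `s_p` is SHARP (rank 0: `EdgeCapRatePlusOne` fails on paper).
   Possibly unnecessary FOR TRUTH (needed by the intended proof, or only by EdgeDecay, or vacuity):
   surjectivity of `ρ̄_{E,p}` (Ochiai's big-image device), `¬ p ∣ a_p² - 1` (for the CRUX's
   inequality: at `a_p ≡ ±1` a `p`-new level-`Np` form congruent to `f_E` may exist — its `U_p = ±1`
   is a unit, so (Br) then fails and the instance is vacuous — and on the vertical line the factor
   `1 − α_k⁻¹` is absorbed by Greenberg–Stevens' improved `L_p^*`; but it IS load-bearing for the
   LINE's exact identity, §5 (P3)), `2a < b` (non-vanishing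
   is EdgeDecay's need; for `a ≥ b` the ratio is central/right-of-centre or non-critical, the latter
   making `hR` unsatisfiable), newness of `g` (redundant given (Br): old eigenforms at level `N`
   would come from a congruent newform of lower level), good reduction at `p` (multiplicative `p`:
   no `p`-new ordinary form of weight `> 2`, vacuous), the extra factor `2` in the modulus.
6. **Evidence (kit job `j023638`, PARI, 1 core, seconds; script `br389.gp` in the seat folder;
   `j023609`/`j023632` were the same script killed by stack settings):** E = 389a1 (conductor = disc
   = 389, analytic rank 2, modular degree 40 = 2³·5); `a_5 = −3`, `a_7 = −5` (both good ordinary,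
   non-anomalous, `a_p ≢ ±1` so no level raising at p); `S₂^{new}(389)` has 5 orbits of degrees
   1, 2, 3, 6, 20 with analytic ranks 2 | 1,1 | 1,1,1 | 1⁶ | 0²⁰; modulo primes above 5 EXACTLY ONE
   congruence with 389a1 away from {5, 389} (all ℓ ≤ 97): the degree-20 orbit 389.2.a.e at its
   ramified prime (e = 2, f = 1), with `v(a_5(g) − a_5(E)) = 1` (so g is 5-ordinary under that
   embedding); modulo primes above 7: NO congruent orbit. Hence (389a1, 5) satisfies every
   admissibility hypothesis EXCEPT (Br) — a rank-0 ordinary congruent branch exists — while at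
   (389a1, 7) (Br) is consistent with all level-389 data (level lowering impossible: prime level,
   `ord_389 Δ = 1`). See `EdgeCapWithoutBr`.
7. **Line `ratio_measure_strassmann`** (registered skeleton, one stub A): see §5 at the end — A as
   registered is false on paper (central index; found by the skeleton-vet seat, Lean certificate
   p145827 pending), the repaired A′ passes this seat's consistency audit (P1–P7).
-/

namespace Summit.BirchSwinnertonDyer.BirchSwinnertonDyer.Cruxes.EdgeCap.Disproof

open MeasureTheory
open Summit.BirchSwinnertonDyer.BirchSwinnertonDyer.Theses.TangentCone
open Literature.NumberTheory.EllipticCurves.ModularForms (coeffField coeff_mem_coeffField IsNewform0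
  IsNormalized)

/-! ## §1 What the typed side conditions force (checked) -/

/-- The typed side conditions of the conclusion (`0 < b`, `2a < b`, `2b(p-1) ∣ k-2`, `2J+3 ≤ k`,
`b(s-1) = a(k-2)`) put the point `(k, s)` exactly where the intended proof needs it: `s ≥ 1` (so the
ℕ-subtraction `s - 1` in the Mellin kernel is genuine), `2s < k` (strictly LEFT of the centre: the
edge value `Λ(g,s)` is non-zero by absolute convergence of the Euler product at `k - s > (k+1)/2`),
`s` odd (same Shimura period as the odd reference point `j`, so `Λ(g,s)/Λ(g,j) ∈ K_g`) and
`2(p-1) ∣ s-1` (the character `x ↦ x^{s-1}` lies on the ω⁰ branch of the two-variable p-adic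
L-function, the branch through (2,1)). [folklore] -/
theorem side_conditions {p a b J s : ℕ} {k : ℤ} (hp : 5 ≤ p) (hb : 0 < b) (hab : 2 * a < b)
    (hk : (2 * b * (p - 1) : ℤ) ∣ (k - 2)) (hkJ : (2 * J + 3 : ℤ) ≤ k)
    (hs : (b : ℤ) * ((s : ℤ) - 1) = a * (k - 2)) :
    1 ≤ s ∧ 2 * (s : ℤ) < k ∧ (2 * ((p : ℤ) - 1)) ∣ ((s : ℤ) - 1) ∧ Odd s := by
  obtain ⟨t, ht⟩ := hk
  have hb' : (0 : ℤ) < b := by exact_mod_cast hb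
  have hp5 : (5 : ℤ) ≤ (p : ℤ) := by exact_mod_cast hp
  have hp1 : (0 : ℤ) < (p : ℤ) - 1 := by linarith
  have hk2 : (0 : ℤ) < k - 2 := by linarith
  have hc : (0 : ℤ) < 2 * (b : ℤ) * ((p : ℤ) - 1) := mul_pos (mul_pos two_pos hb') hp1
  have ht0 : (0 : ℤ) < t := by
    by_contra h
    push Not at h
    have h1 : 0 ≤ 2 * (b : ℤ) * ((p : ℤ) - 1) * (-t) := mul_nonneg hc.le (by linarith)
    linarith [ht]
  have hst : ((s : ℤ) - 1) = 2 * a * ((p : ℤ) - 1) * t := by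
    have h1 : (b : ℤ) * ((s : ℤ) - 1) = (b : ℤ) * (2 * a * ((p : ℤ) - 1) * t) := by
      rw [hs, ht]; ring
    exact mul_left_cancel₀ hb'.ne' h1
  have ha0 : (0 : ℤ) ≤ (a : ℤ) := Nat.cast_nonneg a
  refine ⟨?_, ?_, ⟨a * t, by rw [hst]; ring⟩, ?_⟩
  · have h1 : (0 : ℤ) ≤ (s : ℤ) - 1 := by
      rw [hst]; exact mul_nonneg (mul_nonneg (mul_nonneg (by norm_num) ha0) hp1.le) ht0.le
    omega
  · have hab' : (2 * (a : ℤ)) < b := by exact_mod_cast hab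
    have hpt : (0 : ℤ) < ((p : ℤ) - 1) * t := mul_pos hp1 ht0
    nlinarith [mul_lt_mul_of_pos_right hab' hpt, hst, ht]
  · have h1 : (s : ℤ) = 2 * (a * ((p : ℤ) - 1) * t) + 1 := by linarith [hst]
    exact (Int.odd_coe_nat s).mp ⟨_, h1⟩

/-- The reference point `j` (odd, `3 ≤ j ≤ 2J+1`, with `2J+3 ≤ k`) satisfies `j - 1 ≥ 2` and
`k - 1 - j ≥ 2`: both Euler-factor terms `1 - p^{j-1}/α_k`, `1 - p^{k-1-j}/α_k` at `(k, j)` are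
`≡ 1 (mod p)`, hence p-adic units — no trivial-zero factor in the denominator. Note `j = k/2`
(a CENTRAL value, possibly zero ⇒ `R = 0`) is allowed for the finitely many `k ≤ 4J+2`; those
weights carry one branch member each and are absorbed by `C`. [folklore] -/
theorem j_window {j J : ℕ} {k : ℤ} (_hj : Odd j) (h3 : 3 ≤ j) (hJ : j ≤ 2 * J + 1)
    (hk : (2 * J + 3 : ℤ) ≤ k) : 2 ≤ j - 1 ∧ (j : ℤ) + 2 ≤ k := by
  constructor
  · omega
  · omega

/-- With `J = 0` the window `3 ≤ j ≤ 2J+1` is empty: the prover's `J` must be `≥ 1` as soon as ONE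
admissible datum `(k, g, ι, s)` exists (it does for every `k ≡ 2 mod 2b(p-1)`, `k > 2`, by Hida
theory — on paper). [folklore] -/
theorem no_reference_point_of_J_zero {j : ℕ} : ¬ (Odd j ∧ 3 ≤ j ∧ j ≤ 2 * 0 + 1) := by
  omega

/-! ## §2 Why no junk witness exists (checked) -/

/-- If the edge ratio is `0` (in particular when Lean's `x / 0 = 0` fires because the reference
integral vanishes or is not integrable), the concluding inequality holds for every exponent: the
division junk is prover-friendly, never refuter-friendly. [folklore] -/
theorem bound_of_ratio_eq_zero {Γ : Subgroup (Matrix.GeneralLinearGroup (Fin 2) ℝ)} {k : ℤ}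
    (g : CuspForm Γ k) {p : ℕ} [Fact p.Prime] (ι : coeffField g →+* PadicAlgCl p) {x : ℂ}
    (hx : x = 0)
    (hR : x ∈ coeffField g) (e C : ℕ) :
    ‖ι ⟨x, hR⟩‖ * (p : ℝ) ^ e ≤ (p : ℝ) ^ C := by
  subst hx
  have h0 : (⟨0, hR⟩ : coeffField g) = 0 := rfl
  rw [h0, map_zero, norm_zero, zero_mul]
  positivity

/-- The one cusp form the tree can write down, `g = 0`, has edge ratio `0/0 = 0`, so by
`bound_of_ratio_eq_zero` it satisfies the conclusion of `EdgeCap` at every `(p, s, j, C)`: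
a counterexample needs a genuine (new, ordinary, congruent) form with evaluated Mellin
transforms. [folklore] -/
theorem ratio_eq_zero_of_eq_zero {Γ : Subgroup (Matrix.GeneralLinearGroup (Fin 2) ℝ)} {k : ℤ}
    (g : CuspForm Γ k) (hg : g = 0) (s j : ℕ) :
    (∫ t in Set.Ioi (0 : ℝ), ((t : ℂ) ^ (s - 1)) * g (UpperHalfPlane.ofComplex ((t : ℂ) * Complex.I))) /
      (∫ t in Set.Ioi (0 : ℝ), ((t : ℂ) ^ (j - 1)) * g (UpperHalfPlane.ofComplex ((t : ℂ) * Complex.I)))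
      = 0 := by
  subst hg
  simp

/-- … and `g = 0` is not a newform anyway (`IsNewform0` contains `a₁ = 1`). [folklore] -/
theorem not_isNewform0_zero {N : ℕ} [NeZero N] {k : ℤ} :
    ¬ IsNewform0 (0 : CuspForm (CongruenceSubgroup.Gamma0 N) k) := by
  rintro ⟨-, -, h⟩
  unfold IsNormalized at h
  rw [CuspForm.coe_zero, UpperHalfPlane.qExpansion_zero] at h
  simp at h

/-! ## §3 Load-bearing analysis (variants; refutations are paper-only, see the module docstring) -/

/-- `EdgeCap` with hypothesis (Br) DELETED. EXPECTED FALSE on paper — (Br) is load-bearing.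
Mechanism: without (Br) the residual class 𝔪 of `f_E` may carry a SECOND Hida branch, through an
ordinary weight-2 newform `f' ≡ f_E (mod 𝔭)` of level dividing `N`; its weight-`k` members `g'_k`
satisfy every inner hypothesis (new of level `N` when `N` is prime, ordinary, congruent to `E` away
from `Np`), but their edge ratios `Λ(g'_k,1)/Λ(g'_k,j)` converge p-adically to
`L_p(f',𝟙)/L_p(f',σ_j) ≠ 0` when `L(f',1) ≠ 0`, so `v_p(ι R_k)` stays BOUNDED while the bound
demands `≥ s_p(E)·(1+v_p(k-2)) - C → ∞` (`s_p(E) ≥ rank E(ℚ) ≥ 2`). Witness (kit job `j023638`):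
`E = 389a1` (rank 2, prime conductor, modular degree `40 = 2³·5`), `p = 5` (`a_5 = -3`: good
ordinary, `a_5² - 1 = 8 ≢ 0 mod 5`, `ρ̄_5` surjective since 389a1 is semistable without
5-isogeny), `a = 0`, `b = 1`: the degree-20 orbit `389.2.a.e` is congruent to `f_E` modulo its
ramified prime above 5 at every `ℓ ≤ 97`, `ℓ ∉ {5, 389}`, is 5-ordinary there
(`a_5(g) ≡ a_5(E) = -3`), and has analytic rank 0 at all 20 embeddings — so its Hida branch has
`L_p(f', 𝟙) ≠ 0` and non-decaying vertical edge ratios, against the demanded rate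
`s_5(389a1) ≥ 2`. (No orbit is congruent modulo a prime above 7: (Br) is consistent at (389a1, 7).)
NOT refutable in tree: construction debt (module docstring, item 2). [cite: GreenbergStevens1993] -/
def EdgeCapWithoutBr : Prop :=
  ∀ (W : WeierstrassCurve ℚ) [W.IsElliptic] [W.IsGloballyMinimal] (_ : NeZero (W.conductorNorm ℤ)) (p : ℕ) [Fact p.Prime], 5 ≤ p → W.HasGoodReductionAtPrime p → ¬ (p : ℤ) ∣ W.frobeniusTrace p → ¬ (p : ℤ) ∣ (W.frobeniusTrace p) ^ 2 - 1 → W.HasSurjectiveModNGaloisRep p → ∀ (a b : ℕ), 0 < b → 2 * a < b → ∃ (J C : ℕ), ∀ (k : ℤ) (g : CuspForm (CongruenceSubgroup.Gamma0 (W.conductorNorm ℤ)) k) (ι : Literature.NumberTheory.EllipticCurves.ModularForms.coeffField g →+* PadicAlgCl p) (s : ℕ), (2 * b * (p - 1) : ℤ) ∣ (k - 2) → (2 * J + 3 : ℤ) ≤ k → (b : ℤ) * ((s : ℤ) - 1) = a * (k - 2) → Literature.NumberTheory.EllipticCurves.ModularForms.IsNewform0 g → ‖ι ⟨(UpperHalfPlane.qExpansion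 1 ⇑g).coeff p, Literature.NumberTheory.EllipticCurves.ModularForms.coeff_mem_coeffField g p⟩‖ = 1 → (∀ ℓ : ℕ, ℓ.Prime → ¬ ℓ ∣ W.conductorNorm ℤ * p → ‖ι ⟨(UpperHalfPlane.qExpansion 1 ⇑g).coeff ℓ, Literature.NumberTheory.EllipticCurves.ModularForms.coeff_mem_coeffField g ℓ⟩ - ((W.frobeniusTrace ℓ : ℤ) : PadicAlgCl p)‖ < 1) → ∃ (j : ℕ), Odd j ∧ 3 ≤ j ∧ j ≤ 2 * J + 1 ∧ ∀ hR : (∫ t in Set.Ioi (0 : ℝ), ((t : ℂ) ^ (s - 1)) * g (UpperHalfPlane.ofComplex ((t : ℂ) * Complex.I))) / (∫ t in Set.Ioi (0 : ℝ), ((t : ℂ) ^ (j - 1)) * g (UpperHalfPlane.ofComplex ((t : ℂ) * Complex.I))) ∈ Literature.NumberTheory.EllipticCurves.ModularForms.coeffField g, ‖ι ⟨_, hR⟩‖ * (p : ℝ) ^ (W.selmerCorank p * (1 + padicValInt p (k - 2))) ≤ (p : ℝ) ^ C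

/-- NEAR-MISS (paper refutation of the (Br)-less variant; cannot be closed in tree).
Obstruction: needs (i) a globally minimal model of 389a1 with `HasGoodReductionAtPrime 5`,
`frobeniusTrace 5 = -3`, `HasSurjectiveModNGaloisRep 5` discharged, and (ii) the weight-`k` members
of the congruent branch as terms `g : CuspForm (Gamma0 389) k` with `IsNewform0 g`, an embedding
`ι`, and their two Mellin transforms evaluated in `K_g` — none of which the tree can construct
(2026-08-17). Tried: nothing in Lean beyond typing; the witness data is job `j023638`. -/
theorem edgeCapWithoutBr_false : ¬ EdgeCapWithoutBr := by
  sorry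

/-- `EdgeCap` with the weight modulus weakened from `2b(p-1) ∣ k-2` to `(p-1) ∣ k-2` (the bare
condition for a level-`N`, trivial-character form congruent to `E` to exist in weight `k`:
`det ρ̄ = ω` forces `k ≡ 2 mod p-1`). EXPECTED FALSE on paper — the factor `b(p-1)` is
load-bearing: with `b = p-1`, `a = 2` (`2a < b` for `p ≥ 7`) and `k - 2 = (p-1)t` one gets
`s - 1 = 2t`, still odd `s`, but `x ↦ x^{s-1} = ω^{2t}⟨x⟩^{2t}` lies on the branch `ω^{2t mod (p-1)}`,
which for `t` in a fixed class `≢ 0 mod (p-1)/2` with `v_p(t) → ∞` tends to the point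
`L_p(E, ω^{i}, T = 0) = (unit)·τ(ω^{-i})·L(E, ω^{-i}, 1)/Ω_E` (`i` even, `≠ 0`), non-zero for at
least one such `i` (Rohrlich-type non-vanishing; certainly after varying `p`), so again no decay
while `s_p ≥ 1` is demanded. The extra factor `2` in the route's modulus is NOT needed for
parity/branch (`p - 1` is even): it only thins the progression (harmless; EdgeDecay supplies the
same progression). NOT refutable in tree (construction debt). [cite: GreenbergStevens1993] -/
def EdgeCapModulusPMinusOne : Prop :=
  ∀ (W : WeierstrassCurve ℚ) [W.IsElliptic] [W.IsGloballyMinimal] (_ : NeZero (W.conductorNorm ℤ)) (p : ℕ) [Fact p.Prime], 5 ≤ p → W.HasGoodReductionAtPrime p → ¬ (p : ℤ) ∣ W.frobeniusTrace p → ¬ (p : ℤ) ∣ (W.frobeniusTrace p) ^ 2 - 1 → W.HasSurjectiveModNGaloisRep p → (∀ (M : ℕ) (_ : NeZero M) (g : CuspForm (CongruenceSubgroup.Gamma0 M) 2) (ι : Literature.NumberTheory.EllipticCurves.ModularForms.coeffField g →+* PadicAlgCl p), M ∣ W.conductorNorm ℤ * p → Literature.NumberTheory.EllipticCurves.ModularForms.IsNewform0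 g → ‖ι ⟨(UpperHalfPlane.qExpansion 1 ⇑g).coeff p, Literature.NumberTheory.EllipticCurves.ModularForms.coeff_mem_coeffField g p⟩‖ = 1 → (∀ ℓ : ℕ, ℓ.Prime → ¬ ℓ ∣ W.conductorNorm ℤ * p → ‖ι ⟨(UpperHalfPlane.qExpansion 1 ⇑g).coeff ℓ, Literature.NumberTheory.EllipticCurves.ModularForms.coeff_mem_coeffField g ℓ⟩ - ((W.frobeniusTrace ℓ : ℤ) : PadicAlgCl p)‖ < 1) → M = W.conductorNorm ℤ ∧ ∀ n : ℕ, (UpperHalfPlane.qExpansion 1 ⇑g).coeff n = ((W.LFunction n : ℤ) : ℂ)) → ∀ (a b : ℕ), 0 < b → 2 * a < b → ∃ (J C : ℕ), ∀ (k : ℤ) (g : CuspForm (CongruenceSubgroup.Gamma0 (W.conductorNorm ℤ)) k) (ι : Literature.NumberTheory.EllipticCurves.ModularForms.coeffField g →+* PadicAlgCl p) (s : ℕ), ((p : ℤ) - 1) ∣ (k - 2) → (2 * J + 3 : ℤ) ≤ k → (b : ℤ) * ((s : ℤ) - 1) = a * (k - 2) → Literature.NumberTheory.EllipticCurves.ModularForms.IsNewform0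 g → ‖ι ⟨(UpperHalfPlane.qExpansion 1 ⇑g).coeff p, Literature.NumberTheory.EllipticCurves.ModularForms.coeff_mem_coeffField g p⟩‖ = 1 → (∀ ℓ : ℕ, ℓ.Prime → ¬ ℓ ∣ W.conductorNorm ℤ * p → ‖ι ⟨(UpperHalfPlane.qExpansion 1 ⇑g).coeff ℓ, Literature.NumberTheory.EllipticCurves.ModularForms.coeff_mem_coeffField g ℓ⟩ - ((W.frobeniusTrace ℓ : ℤ) : PadicAlgCl p)‖ < 1) → ∃ (j : ℕ), Odd j ∧ 3 ≤ j ∧ j ≤ 2 * J + 1 ∧ ∀ hR : (∫ t in Set.Ioi (0 : ℝ), ((t : ℂ) ^ (s - 1)) * g (UpperHalfPlane.ofComplex ((t : ℂ) * Complex.I))) / (∫ t in Set.Ioi (0 : ℝ), ((t : ℂ) ^ (j - 1)) * g (UpperHalfPlane.ofComplex ((t : ℂ) * Complex.I))) ∈ Literature.NumberTheory.EllipticCurves.ModularForms.coeffField g, ‖ι ⟨_, hR⟩‖ * (p : ℝ) ^ (W.selmerCorank p * (1 + padicValInt p (k - 2))) ≤ (p : ℝ) ^ C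

/-- `EdgeCap` with the ordinarity `‖ι a_p(g)‖ = 1` of the branch member DELETED from the
conclusion's hypotheses (the outer ordinarity of `E` at `p` kept). EXPECTED FALSE on paper —
ordinarity of `g` is load-bearing: `dim S_k(Γ₀(N))` grows linearly in `k` while the residual
representations of level `N` are finitely many, so for large `k ≡ 2 mod 2b(p-1)` most newforms
congruent to `E` away from `Np` have POSITIVE slope; they lie on no Hida branch, their edge ratios
are not interpolated by `L_p(f_∞)` and have no reason to decay at rate `s_p`. (With ordinarity
kept, (Br) makes the member unique: `𝕋_𝔪 ≅ Λ`.) NOT refutable in tree. [cite: Hida1986] -/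
def EdgeCapNonOrdinaryMembers : Prop :=
  ∀ (W : WeierstrassCurve ℚ) [W.IsElliptic] [W.IsGloballyMinimal] (_ : NeZero (W.conductorNorm ℤ)) (p : ℕ) [Fact p.Prime], 5 ≤ p → W.HasGoodReductionAtPrime p → ¬ (p : ℤ) ∣ W.frobeniusTrace p → ¬ (p : ℤ) ∣ (W.frobeniusTrace p) ^ 2 - 1 → W.HasSurjectiveModNGaloisRep p → (∀ (M : ℕ) (_ : NeZero M) (g : CuspForm (CongruenceSubgroup.Gamma0 M) 2) (ι : Literature.NumberTheory.EllipticCurves.ModularForms.coeffField g →+* PadicAlgCl p), M ∣ W.conductorNorm ℤ * p → Literature.NumberTheory.EllipticCurves.ModularForms.IsNewform0 g → ‖ι ⟨(UpperHalfPlane.qExpansion 1 ⇑g).coeff p, Literature.NumberTheory.EllipticCurves.ModularForms.coeff_mem_coeffField g p⟩‖ = 1 → (∀ ℓ : ℕ, ℓ.Prime → ¬ ℓ ∣ W.conductorNorm ℤ * p → ‖ι ⟨(UpperHalfPlane.qExpansion 1 ⇑g).coeff ℓ, Literature.NumberTheory.EllipticCurves.ModularForms.coeff_mem_coeffField g ℓ⟩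 - ((W.frobeniusTrace ℓ : ℤ) : PadicAlgCl p)‖ < 1) → M = W.conductorNorm ℤ ∧ ∀ n : ℕ, (UpperHalfPlane.qExpansion 1 ⇑g).coeff n = ((W.LFunction n : ℤ) : ℂ)) → ∀ (a b : ℕ), 0 < b → 2 * a < b → ∃ (J C : ℕ), ∀ (k : ℤ) (g : CuspForm (CongruenceSubgroup.Gamma0 (W.conductorNorm ℤ)) k) (ι : Literature.NumberTheory.EllipticCurves.ModularForms.coeffField g →+* PadicAlgCl p) (s : ℕ), (2 * b * (p - 1) : ℤ) ∣ (k - 2) → (2 * J + 3 : ℤ) ≤ k → (b : ℤ) * ((s : ℤ) - 1) = a * (k - 2) → Literature.NumberTheory.EllipticCurves.ModularForms.IsNewform0 g → (∀ ℓ : ℕ, ℓ.Prime → ¬ ℓ ∣ W.conductorNorm ℤ * p → ‖ι ⟨(UpperHalfPlane.qExpansion 1 ⇑g).coeff ℓ, Literature.NumberTheory.EllipticCurves.ModularForms.coeff_mem_coeffField g ℓ⟩ - ((W.frobeniusTrace ℓ : ℤ) : PadicAlgCl p)‖ < 1) → ∃ (j : ℕ), Odd j ∧ 3 ≤ j ∧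 j ≤ 2 * J + 1 ∧ ∀ hR : (∫ t in Set.Ioi (0 : ℝ), ((t : ℂ) ^ (s - 1)) * g (UpperHalfPlane.ofComplex ((t : ℂ) * Complex.I))) / (∫ t in Set.Ioi (0 : ℝ), ((t : ℂ) ^ (j - 1)) * g (UpperHalfPlane.ofComplex ((t : ℂ) * Complex.I))) ∈ Literature.NumberTheory.EllipticCurves.ModularForms.coeffField g, ‖ι ⟨_, hR⟩‖ * (p : ℝ) ^ (W.selmerCorank p * (1 + padicValInt p (k - 2))) ≤ (p : ℝ) ^ C

/-- TIGHTNESS variant: `EdgeCap` with the rate `s_p` replaced by `s_p + 1`. EXPECTED FALSE on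
paper — the rate is sharp already in analytic rank 0: for `E = 11a1`, `p = 7` (`a_7 = -2`: good
ordinary, `a_7² - 1 = 3`, `ρ̄_7` surjective, (Br) holds since `S_2(Γ₀(M)) = 0` for `M ∣ 7` and
level raising to `77` needs `a_7 ≡ ±8 (mod 7)`), `s_7 = 0` (Kato/Kolyvagin) and
`L_p(E, T=0) = (1 - α⁻¹)² L(E,1)/Ω_E ≠ 0` (Greenberg–Stevens 1993 Thm 7.1 regime), so the vertical
edge ratios `Λ(g_k,1)/Λ(g_k,j)` have BOUNDED valuation, contradicting the demanded rate
`1·(1+v_p(k-2))`. In rank 2 sharpness at (389a1, 7) is the 2001 computation `n_7 = 2` (Thm F).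
So no prover should try to gain a `+1` in the exponent. NOT refutable in tree. [cite: GreenbergStevens1993, Thm 7.1] -/
def EdgeCapRatePlusOne : Prop :=
  ∀ (W : WeierstrassCurve ℚ) [W.IsElliptic] [W.IsGloballyMinimal] (_ : NeZero (W.conductorNorm ℤ)) (p : ℕ) [Fact p.Prime], 5 ≤ p → W.HasGoodReductionAtPrime p → ¬ (p : ℤ) ∣ W.frobeniusTrace p → ¬ (p : ℤ) ∣ (W.frobeniusTrace p) ^ 2 - 1 → W.HasSurjectiveModNGaloisRep p → (∀ (M : ℕ) (_ : NeZero M) (g : CuspForm (CongruenceSubgroup.Gamma0 M) 2) (ι : Literature.NumberTheory.EllipticCurves.ModularForms.coeffField g →+* PadicAlgCl p), M ∣ W.conductorNorm ℤ * p → Literature.NumberTheory.EllipticCurves.ModularForms.IsNewform0 g → ‖ι ⟨(UpperHalfPlane.qExpansion 1 ⇑g).coeff p, Literature.NumberTheory.EllipticCurves.ModularForms.coeff_mem_coeffField g p⟩‖ = 1 → (∀ ℓ : ℕ, ℓ.Prime → ¬ ℓ ∣ W.conductorNorm ℤ * p → ‖ι ⟨(UpperHalfPlane.qExpansion 1 ⇑g).coeff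 ℓ, Literature.NumberTheory.EllipticCurves.ModularForms.coeff_mem_coeffField g ℓ⟩ - ((W.frobeniusTrace ℓ : ℤ) : PadicAlgCl p)‖ < 1) → M = W.conductorNorm ℤ ∧ ∀ n : ℕ, (UpperHalfPlane.qExpansion 1 ⇑g).coeff n = ((W.LFunction n : ℤ) : ℂ)) → ∀ (a b : ℕ), 0 < b → 2 * a < b → ∃ (J C : ℕ), ∀ (k : ℤ) (g : CuspForm (CongruenceSubgroup.Gamma0 (W.conductorNorm ℤ)) k) (ι : Literature.NumberTheory.EllipticCurves.ModularForms.coeffField g →+* PadicAlgCl p) (s : ℕ), (2 * b * (p - 1) : ℤ) ∣ (k - 2) → (2 * J + 3 : ℤ) ≤ k → (b : ℤ) * ((s : ℤ) - 1) = a * (k - 2) → Literature.NumberTheory.EllipticCurves.ModularForms.IsNewform0 g → ‖ι ⟨(UpperHalfPlane.qExpansion 1 ⇑g).coeff p, Literature.NumberTheory.EllipticCurves.ModularForms.coeff_mem_coeffField g p⟩‖ = 1 → (∀ ℓ : ℕ, ℓ.Prime → ¬ ℓ ∣ W.conductorNorm ℤ * p → ‖ι ⟨(UpperHalfPlane.qExpansion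 1 ⇑g).coeff ℓ, Literature.NumberTheory.EllipticCurves.ModularForms.coeff_mem_coeffField g ℓ⟩ - ((W.frobeniusTrace ℓ : ℤ) : PadicAlgCl p)‖ < 1) → ∃ (j : ℕ), Odd j ∧ 3 ≤ j ∧ j ≤ 2 * J + 1 ∧ ∀ hR : (∫ t in Set.Ioi (0 : ℝ), ((t : ℂ) ^ (s - 1)) * g (UpperHalfPlane.ofComplex ((t : ℂ) * Complex.I))) / (∫ t in Set.Ioi (0 : ℝ), ((t : ℂ) ^ (j - 1)) * g (UpperHalfPlane.ofComplex ((t : ℂ) * Complex.I))) ∈ Literature.NumberTheory.EllipticCurves.ModularForms.coeffField g, ‖ι ⟨_, hR⟩‖ * (p : ℝ) ^ ((W.selmerCorank p + 1) * (1 + padicValInt p (k - 2))) ≤ (p : ℝ) ^ C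

/-- NEAR-MISS (paper refutation of the sharpened rate; cannot be closed in tree). Obstruction as in
`edgeCapWithoutBr_false`: needs 11a1's minimal model with its local hypotheses at 7 discharged,
(Br) at (11a1, 7) proved (a classification of the 7-ordinary newforms of level dividing 77), and
the weight-`k` branch members through `f_{11a1}` as `CuspForm` terms with evaluated Mellin
transforms. -/
theorem edgeCapRatePlusOne_false : ¬ EdgeCapRatePlusOne := by
  sorry

/-! ## §4 Sanity: the variants are genuine weakenings/strengthenings of the crux (checked) -/

/-- Deleting (Br) weakens the hypotheses: the variant implies the crux. [folklore] -/
theorem edgeCap_of_withoutBr (h : EdgeCapWithoutBr) : EdgeCap := by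
  intro W _ _ hN p _ hp5 hgood hord hna hsurj _hBr a b hb hab
  exact h W hN p hp5 hgood hord hna hsurj a b hb hab

/-- Weakening the modulus strengthens the statement: the variant implies the crux. [folklore] -/
theorem edgeCap_of_modulusPMinusOne (h : EdgeCapModulusPMinusOne) : EdgeCap := by
  intro W _ _ hN p _ hp5 hgood hord hna hsurj hBr a b hb hab
  obtain ⟨J, C, hJC⟩ := h W hN p hp5 hgood hord hna hsurj hBr a b hb hab
  refine ⟨J, C, fun k g ι s hk hkJ hs hnew hordg hcong => ?_⟩
  have hdiv : ((p : ℤ) - 1) ∣ (2 * b * (p - 1) : ℤ) := ⟨2 * b, by ring⟩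
  exact hJC k g ι s (hdiv.trans hk) hkJ hs hnew hordg hcong

/-- Deleting the member's ordinarity strengthens the statement: the variant implies the crux. [folklore] -/
theorem edgeCap_of_nonOrdinaryMembers (h : EdgeCapNonOrdinaryMembers) : EdgeCap := by
  intro W _ _ hN p _ hp5 hgood hord hna hsurj hBr a b hb hab
  obtain ⟨J, C, hJC⟩ := h W hN p hp5 hgood hord hna hsurj hBr a b hb hab
  exact ⟨J, C, fun k g ι s hk hkJ hs hnew _hordg hcong => hJC k g ι s hk hkJ hs hnew hcong⟩

/-- Raising the rate strengthens the statement: the variant implies the crux (`p ≥ 1`). [folklore] -/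
theorem edgeCap_of_ratePlusOne (h : EdgeCapRatePlusOne) : EdgeCap := by
  intro W _ _ hN p _ hp5 hgood hord hna hsurj hBr a b hb hab
  obtain ⟨J, C, hJC⟩ := h W hN p hp5 hgood hord hna hsurj hBr a b hb hab
  refine ⟨J, C, fun k g ι s hk hkJ hs hnew hordg hcong => ?_⟩
  obtain ⟨j, hjo, hj3, hjJ, hb⟩ := hJC k g ι s hk hkJ hs hnew hordg hcong
  refine ⟨j, hjo, hj3, hjJ, fun hR => le_trans ?_ (hb hR)⟩
  have hp1 : (1 : ℝ) ≤ (p : ℝ) := by exact_mod_cast (Fact.out : p.Prime).one_lt.le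
  exact mul_le_mul_of_nonneg_left
    (pow_le_pow_right₀ hp1 (Nat.mul_le_mul_right _ (Nat.le_succ _))) (norm_nonneg _)

/-! ## §5 Line `ratio_measure_strassmann` (registered skeleton `db39b1a9…`, ONE stub A = `stub_ratioInterpolant`)

Not in this seat's payload (`line: null`); read at the cycle boundary because v4 reduces the crux,
kernel-checked, to `A → EdgeCap`.

* **A AS REGISTERED (v4) IS FALSE ON PAPER** — clause (ii) admits the CENTRAL index `j = k/2`
  (range `(j:ℤ) + 2 ≤ k`); for a root-number `−1` curve with an admissible prime (37a1, p = 5)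
  the central values of all branch members vanish (sign constant on `k ≡ 2 mod 2(p−1)`), Lean's
  `x/0 = 0` makes `R_{k/2} = 0 ∈ K_g`, so (ii) forces `F(x_k, y_s) = 0`, then `F(x_k, y_j) = 0`
  off-centre (`R_j ≠ 0`), then Strassmann in the weight variable and in the fibre at `x = 0` gives
  `F(0, ·) ≡ 0`, contradicting (i). Finder: seat `refuter-skel-…-vet-0`
  (`Cruxes/EdgeCap/SKELVET-stub_ratioInterpolant.md`); Lean certificate modulo the
  central-vanishing data: proposal p145827
  `Theorems/EdgeCap/Negative/StubRatioInterpolantFalseOfCentralVanishing.lean` (pending 07:04Z) over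
  the LANDED helpers `Theorems/EdgeCap/Negative/FibreStrassmann.lean` (p145772:
  `fibre_eq_zero_of_zeros`, `weightFibre_eq_zero_of_zeros`, …). Not duplicated here. Repair (vet):
  `2 * (j:ℤ) + 2 ≤ k`, `EdgeCap_of` re-threads with `J := 2·J_U + 1`.
* **A′ (= A with `2*(j:ℤ)+2 ≤ k`) PASSES this seat's paper consistency audit:**
  (P1) (iii) at `t = 0` reads `‖F(0,0)‖ ≤ 0^{s_p}` — `0^0 = 1` for `s_p = 0`, and `F(0,0) = 0` for
       `s_p ≥ 1`, as it must be;
  (P2) the constant EXACTLY `1` in (iii) is right: `F∘arc ∈ ℤ_p⟦T⟧` (`u^{bT} − 1` has coefficients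
       `(b·log u)^n/n!`, `v_p ≥ n − v_p(n!) > 0`), and an integral one-variable series of order
       `≥ s_p` at `0` is `T^{s_p}·(integral)`; dividing the two-variable function by its vertical
       content `c(X)` keeps `F` integral and leaves the order along the arc unchanged (`c(0) ≠ 0`,
       Rohrlich on the ω⁰ branch of `L_p(E)`);
  (P3) (ii′) is an EXACT norm identity: for conductor-one characters the MTT multiplier is
       `e_p(k,n) = (1 − p^{n−1}/α_k)(1 − p^{k−1−n}/α_k)` with NO extra power of `p`, a unit for
       `2 ≤ n ≤ k−2` and at `n = s = 1` iff `a_p ≢ 1 (mod p)`; the Kitagawa period `Per_k^±`, the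
       sign, and the `±2π` between `Λ(g,n) = Γ(n)(2π)^{−n}L(g,n)` and MTT's `(n−1)!/(−2πi)^{n−1}`
       are common to numerator and denominator (`s ≡ j ≡ 1 mod 2`) and cancel. COROLLARY:
       `¬ p ∣ a_p² − 1` is LOAD-BEARING FOR THE LINE at `a = 0` (without `a_p ≢ 1` the identity is
       off by `‖1 − α_k⁻¹‖ < 1`, which varies with `k` and divides `L(X,0)` but not `L(X,Y)`:
       Greenberg–Stevens' improved `L_p^*`, GS93 Prop 5.8), whereas the CRUX's inequality could
       absorb that factor — so the hypothesis is not droppable along this line;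
  (P4) (i) over `ℚ_p`-points is achievable: after dividing by `c = gcd_i f_i ∈ ℤ_p⟦X⟧` (UFD), a
       vanishing fibre at `x` would make the distinguished factor of `X − x` divide every `f_i/c`;
  (P5) both interpolation points lie on the ω⁰ branch: `s ≡ 1 (mod p−1)` by `side_conditions`,
       `j` by the typed `(p−1) ∣ (j−1)` — LOAD-BEARING (else (ii′) equates an ω⁰ value with an
       `ω^{j−1}`-twisted one; false on paper);
  (P6) ONE `F` can satisfy (ii′) only if the member `(g, ι)` is unique per weight; this follows from
       the TYPED (Br): the 𝔪-part of `S₂(Γ₀(Np))^{ord}` is the line `ℚ̄_p·f_E^{(α)}` (no lower-level,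
       same-level or p-new ordinary congruent newform; `f_E^{(β)}` is not ordinary), so
       `rank_Λ 𝕋_𝔪 = 1`, `𝕋_𝔪 ≅ Λ` (Hida freeness, `p ≥ 5`), and at weight `k` the 𝔪-part of
       `S_k(Γ₀(Np))^{ord}` is one line — which also forces the member to be NEW OF LEVEL EXACTLY
       `N` (an old member would bring its degeneracy translates): quantifying the conclusion over
       `IsNewform0 g` at level `conductorNorm` loses no member and admits no stranger;
  (P7) the remaining genuine risk is (iii) alone: Euler-system divisibility over the arc ring
       `ℤ_p⟦X,Y⟧/((1+Y)^b − (1+X)^a) ≅ ℤ_p⟦T⟧` plus control at `T = 0` (card risks R1 split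
       multiplicative `ℓ`, R2 pseudo-null — moot over the one-variable arc, where
       `rank M/TM ≤ ord_T char M` holds). Deep, not refutable; no counter-mechanism found.
-/

end Summit.BirchSwinnertonDyer.BirchSwinnertonDyer.Cruxes.EdgeCap.Disproof
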